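import Literature.Computability.AlgebraicComplexity.BIPPaddingDegenerations
import Literature.Computability.AlgebraicComplexity.MultiplicityObstructionsProofs
import Literature.RepresentationTheory.Semisimple.SubrepresentationEquiv
import HarnessLib

/-!
# Monotonicity of occurrence obstructions under degeneration over `ℂ` — discharge of
`hasOccurrenceObstruction_of_mem_orbitClosure_complex`

Topic `Literature/Computability/AlgebraicComplexity`; provefact unit for the named fact
`Literature.Computability.AlgebraicComplexity.hasOccurrenceObstruction_of_mem_orbitClosure_complex`
of `BIPPaddingDegenerations.lean` (Bürgisser–Ikenmeyer–Panova, J. AMS 32 (2019) =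
arXiv:1604.06431v3, §1(a)). The fact renders, in the tree's abstract form, the sentence of §1(a):

> "If the latter is contained in `Ω_n`, then `Z_{n,m} ⊆ Ω_n`, and the restriction defines a
> surjective `G`-equivariant homomorphism `ℂ[Ω_n] → ℂ[Z_{n,m}]` of the coordinate rings. Schur's
> lemma implies that if `λ` occurs in `ℂ[Z_{n,m}]`, then it must also occur in `ℂ[Ω_n]`."

namely: if `g' ∈ Δ[g]` and some irreducible `W' ≤ ℂ[Δ[g']]_d` admits no nonzero equivariant map
to `ℂ[Δ[f]]_d` (an occurrence obstruction against `g' ∈ Δ[f]`), then some irreducible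
`W ≤ ℂ[Δ[g]]_d` admits none either (an occurrence obstruction against `g ∈ Δ[f]`). This file
PROVES it (`hasOccurrenceObstruction_of_mem_orbitClosure_complex_holds`), following the printed
architecture with the semisimplicity input that the tree already supplies algebraically:

1. restriction `ℂ[Δ[g]]_d ↠ ℂ[Δ[g']]_d` is a `GL`-equivariant surjection — the in-tree obstruction
   principle `not_hasMultiplicityObstruction_of_mem_orbitClosure` (`GCTObstructions.lean`);
2. `ℂ[Δ[g]]_d` is completely reducible — `isSemisimpleRepresentation_orbitCoordRep`
   (`MultiplicityObstructionsProofs.lean`, Schur–Weyl via Bläser–Ikenmeyer Thm. 10.9) restricted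
   to the degree piece;
3. hence the surjection has an equivariant section `s` (`exists_section_of_surjective`), and
   `W := s(W') ≤ ℂ[Δ[g]]_d` is an isomorphic copy of `W'` (`Subrepresentation.equivRange`): it is
   irreducible (`Representation.isIrreducible_of_equiv`) and every intertwiner
   `W → ℂ[Δ[f]]_d` pulls back to one out of `W'`, hence vanishes ("Schur's lemma" in the printed
   sentence is exactly this transport of (non-)occurrence along the section).

As a consequence the conditional corollary `not_hasOccurrenceObstruction_paddedPerPoly_of_succ`
of `BIPPaddingDegenerations.lean` loses its monotonicity hypothesis
(`not_hasOccurrenceObstruction_paddedPerPoly_of_succ_of_bip`): only BIP's Theorem 1.4 itself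
(`Literature.Computability.Complexity.bip2019_not_hasOccurrenceObstruction`, a named fact) remains
as input.

## References

* P. Bürgisser, C. Ikenmeyer, G. Panova, *No occurrence obstructions in geometric complexity
  theory*, J. AMS 32 (2019) 163–193 = arXiv:1604.06431v3, §1(a) (restriction epimorphism and
  Schur's lemma), Thm. 1.4. [BurgisserIkenmeyerPanovaJAMS2019]
* M. Bläser, C. Ikenmeyer, *Introduction to Geometric Complexity Theory*, Theory of Computing
  Graduate Surveys 10 (2025), Thm. 10.9, Lemma 12.11, Cor. 12.6 (complete reducibility and
  lifting along equivariant surjections). [BlaeserIkenmeyer2025]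

## Tree

`HasOccurrenceObstruction`, `orbitCoordRepDeg`, `orbitCoordSubrep`,
`not_hasMultiplicityObstruction_of_mem_orbitClosure` (`GCTObstructions`);
`isSemisimpleRepresentation_orbitCoordRep`, `exists_section_of_surjective`
(`MultiplicityObstructionsProofs`); `isSemisimpleRepresentation_toRepresentation`
(`NumberTheory/DiophantineGeometry/GLPolynomialRepSemisimpleProofs`);
`Subrepresentation.equivRange` (`RepresentationTheory/FiniteGroups/EquivOfCharacter`),
`Representation.isIrreducible_of_equiv` (`RepresentationTheory/Semisimple/SubrepresentationEquiv`).
Mathlib: `Representation.IntertwiningMap` (`comp`, `range`), `Representation.Equiv`,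
`Submodule.inclusion`.
-/

noncomputable section

open MvPolynomial Representation

namespace Literature.Computability.AlgebraicComplexity

/-- **Monotonicity of occurrence obstructions under degeneration over `ℂ`** — discharge of the
named fact `hasOccurrenceObstruction_of_mem_orbitClosure_complex` (`BIPPaddingDegenerations.lean`).
If `g' ∈ Δ[g]` and an irreducible `W' ≤ ℂ[Δ[g']]_d` has no nonzero equivariant map to
`ℂ[Δ[f]]_d`, then the isomorphic lift `W ≤ ℂ[Δ[g]]_d` of `W'` along an equivariant section of the
restriction epimorphism `ℂ[Δ[g]]_d ↠ ℂ[Δ[g']]_d` (which exists by complete reducibility of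
`ℂ[Δ[g]]_d`) is irreducible and has no nonzero equivariant map to `ℂ[Δ[f]]_d` either.
[cite: BurgisserIkenmeyerPanovaJAMS2019, §1(a) (restriction epimorphism and Schur's lemma)] -/
theorem hasOccurrenceObstruction_of_mem_orbitClosure_complex_holds :
    hasOccurrenceObstruction_of_mem_orbitClosure_complex := by
  intro σ _ _ f g g' m d _ _ h hobs
  obtain ⟨W', hW'le, hW'irr, hW'⟩ := hobs
  -- (1) the restriction epimorphism `ℂ[Δ[g]]_d ↠ ℂ[Δ[g']]_d` (obstruction principle)
  obtain ⟨φ, hφ⟩ := not_not.mp (not_hasMultiplicityObstruction_of_mem_orbitClosure (m := m) h d)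
  -- (2) `ℂ[Δ[g]]_d` is completely reducible
  have hss : (orbitCoordRepDeg g m d).IsSemisimpleRepresentation :=
    Literature.NumberTheory.DiophantineGeometry.isSemisimpleRepresentation_toRepresentation
      (orbitCoordSubrep g m d) (isSemisimpleRepresentation_orbitCoordRep g m)
  -- (3) an equivariant section of the restriction
  obtain ⟨s, hs⟩ := exists_section_of_surjective φ hφ hss
  -- the equivariant embedding `W' ↪ ℂ[Δ[g']]_d → ℂ[Δ[g]]_d ↪ ℂ[Δ[g]]`
  let ι' : W'.toRepresentation.IntertwiningMap (orbitCoordRepDeg g' m d) :=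
    ⟨Submodule.inclusion hW'le, fun _ => rfl⟩
  let sub : (orbitCoordRepDeg g m d).IntertwiningMap (orbitCoordRep g m) :=
    ⟨(orbitCoordRingDeg g m d).subtype, fun _ => rfl⟩
  let j : W'.toRepresentation.IntertwiningMap (orbitCoordRep g m) := sub.comp (s.comp ι')
  have hj : Function.Injective j := by
    intro x y hxy
    have h1 : s (ι' x) = s (ι' y) := Subtype.ext hxy
    have h2 : Submodule.inclusion hW'le x = Submodule.inclusion hW'le y := by
      have h3 := congrArg φ h1
      rwa [hs, hs] at h3
    exact Submodule.inclusion_injective hW'le h2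
  -- `W := j(W')`, an isomorphic copy of `W'` inside `ℂ[Δ[g]]_d`
  let e : W'.toRepresentation.Equiv j.range.toRepresentation :=
    Literature.RepresentationTheory.FiniteGroups.Subrepresentation.equivRange j hj
  refine ⟨j.range, ?_, ?_, ?_⟩
  · rintro _ ⟨x, rfl⟩
    exact (s (ι' x)).2
  · haveI := hW'irr
    exact Literature.RepresentationTheory.Semisimple.Representation.isIrreducible_of_equiv e
  · intro ψ
    have h0 : ψ.comp e.toIntertwiningMap = 0 := hW' _
    refine Representation.IntertwiningMap.ext (LinearMap.ext fun y => ?_)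
    obtain ⟨x, rfl⟩ := e.toLinearEquiv.surjective y
    have hx := DFunLike.congr_fun h0 x
    rw [Representation.IntertwiningMap.comp_apply] at hx
    exact hx

/-- **The fresh-padding variant from the printed theorem, now with the monotonicity proved.**
Granted only BIP's Theorem 1.4 as printed (`bip2019_not_hasOccurrenceObstruction`, over
`bipPaddedPerPoly`), for `1 ≤ d` and `(m+1)²⁵ ≤ n` there is no occurrence obstruction against
`paddedPerPoly ℂ m n ∈ Δ[det_n]` in degree `d` (`not_hasOccurrenceObstruction_paddedPerPoly_of_succ`
fed with `hasOccurrenceObstruction_of_mem_orbitClosure_complex_holds`).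
[cite: BurgisserIkenmeyerPanovaJAMS2019, Thm. 1.4 applied at `m + 1`, with §1(a)] -/
theorem not_hasOccurrenceObstruction_paddedPerPoly_of_succ_of_bip
    (h : Complexity.bip2019_not_hasOccurrenceObstruction)
    (m n d : ℕ) [NeZero n] (hd : 1 ≤ d) (hn : (m + 1) ^ 25 ≤ n) :
    ¬ HasOccurrenceObstruction (detPoly (Fin n) ℂ) (paddedPerPoly ℂ m n) n d :=
  not_hasOccurrenceObstruction_paddedPerPoly_of_succ h
    hasOccurrenceObstruction_of_mem_orbitClosure_complex_holds m n d hd hn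

end Literature.Computability.AlgebraicComplexity
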